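import Summits.Ventures.QEC.Census.RankCert
import HarnessLib

/-!
# Logical bases of a CSS distance certificate (plan/CERT-FORMAT.md v1 §3 `logicals`, obligation O4, lemma L1)

CERT-FORMAT's `logicals = {LX, LZ}` are PAIRED bases (`|h ∩ LX_i|` even for `h ∈ HZ`, `|h ∩ LZ_j|` even for
`h ∈ HX`, `|LX_i ∩ LZ_j|` odd iff `i = j`). LEMMA L1 is proved here in the side-generic form the Brouwer–Zimmermann
checker needs (syndrome rows `Hsyn`, stabilizer rows `Hstab`, the side's logicals `L`, their duals `Ld`; for side
`Z`: `Hsyn = HX`, `Hstab = HZ`, `L = LZ`, `Ld = LX`): if the two rank certificates check (lemma L0 = type-02's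
`Census/RankCert.lean`), the pairing check `logOK` passes, and `n = r_syn + r_stab + k`, then

  `ker Hsyn = rowspace Hstab ⊔ span L`   (`ker_eq_rowSpace_sup_span`),

so every `z` with `Hsyn z = 0` is `s + Σ aᵢ Lᵢ` with `s ∈ rowspace Hstab` (`exists_coeffs_of_ker`), and the
coefficients are forced: `Σ aᵢ Lᵢ ∈ rowspace Hstab → a = 0` (`coeffs_eq_zero_of_sum_mem_rowSpace`). Proof = the
dimension count of CERT-FORMAT §4 L1: the logicals are independent modulo `rowspace Hstab` (pair with the duals
`Ld_j ∈ ker Hstab`), so `dim (rowspace Hstab ⊔ span L) = r_stab + k = n − r_syn = dim ker Hsyn` (rank–nullity,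
type-02's `rank_add_finrank_pcCode`). The Bool check `logOK` is `List`/`Nat` only (CERT-FORMAT §4 O4, one side).
-/

namespace Summit.Ventures.QEC.Census

open Matrix Literature.InformationTheory.QuantumCodes

/-! ## The pairing check -/

/-- `logOK n Hsyn Hstab L Ld`: `|L| = |Ld|`; every `L_i` has zero `Hsyn`-syndrome; every `Ld_j` has zero
`Hstab`-syndrome; `|L_i ∩ Ld_j|` is odd iff `i = j` (CERT-FORMAT §4 O4, one side). (definition) -/
def logOK (n : ℕ) (Hsyn Hstab L Ld : List ℕ) : Bool :=
  (L.length == Ld.length) && (L.all fun l => synZero n Hsyn l) && (Ld.all fun l => synZero n Hstab l) &&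
    ((List.range L.length).all fun i => (List.range L.length).all fun j =>
      popc n (L.getD i 0 &&& Ld.getD j 0) % 2 == if i = j then 1 else 0)

/-- The `i`-th logical as a vector. -/
def logVec (n : ℕ) (L : List ℕ) (i : Fin L.length) : Fin n → ZMod 2 := ofBits n L[i]

section L1

variable {n : ℕ} {Hsyn Hstab L Ld : List ℕ} {rcY rcS : RankCert}

/-- Unpacking `logOK`: the pairing as dot products, `Ld_j · L_i = [i = j]`. -/
theorem dual_dotProduct_logVec (h : logOK n Hsyn Hstab L Ld = true) (i j : Fin L.length) :
    ofBits n (Ld.getD j 0) ⬝ᵥ logVec n L i = if i = j then 1 else 0 := by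
  simp only [logOK, Bool.and_eq_true, List.all_eq_true, List.mem_range, beq_iff_eq] at h
  obtain ⟨⟨⟨-, -⟩, -⟩, hpair⟩ := h
  have hd := hpair i i.2 j j.2
  have hget : L.getD (i : ℕ) 0 = L[i] := by simp [List.getD_eq_getElem?_getD]
  rw [hget] at hd
  rw [dotProduct_comm, logVec, ofBits_dotProduct]
  by_cases hij : i = j
  · subst hij
    rw [if_pos rfl] at hd
    rw [if_pos rfl]
    have h01 : ∀ x : ZMod 2, x ≠ 0 → x = 1 := by decide
    exact h01 _ ((natCast_zmod2_ne_zero_iff _).2 hd)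
  · have hne : (i : ℕ) ≠ (j : ℕ) := fun e => hij (Fin.ext e)
    rw [if_neg hne] at hd
    rw [if_neg hij, (natCast_zmod2_eq_zero_iff _).2 hd]

/-- Unpacking `logOK`: the duals lie in `ker Hstab`. -/
theorem mulVec_dual_eq_zero (h : logOK n Hsyn Hstab L Ld = true) (j : Fin L.length) :
    rowMatrix n Hstab *ᵥ ofBits n (Ld.getD j 0) = 0 := by
  simp only [logOK, Bool.and_eq_true, List.all_eq_true, beq_iff_eq] at h
  obtain ⟨⟨⟨hlen, -⟩, hLd⟩, -⟩ := h
  have hj : (j : ℕ) < Ld.length := hlen ▸ j.2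
  have hget : Ld.getD (j : ℕ) 0 = Ld[(j : ℕ)] := by simp [List.getD_eq_getElem?_getD, List.getElem?_eq_getElem hj]
  rw [hget]
  exact (synZero_iff _ _ _).1 (hLd _ (List.getElem_mem hj))

/-- Unpacking `logOK`: the logicals lie in `ker Hsyn`. -/
theorem mulVec_logVec_eq_zero (h : logOK n Hsyn Hstab L Ld = true) (i : Fin L.length) :
    rowMatrix n Hsyn *ᵥ logVec n L i = 0 := by
  simp only [logOK, Bool.and_eq_true, List.all_eq_true, beq_iff_eq] at h
  obtain ⟨⟨⟨-, hL⟩, -⟩, -⟩ := h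
  exact (synZero_iff _ _ _).1 (hL _ (List.getElem_mem i.2))

/-- **The coefficients are forced**: a combination `Σ aᵢ Lᵢ` of the logicals that is a stabilizer-row combination
is trivial, `a = 0` (pair with the dual `Ld_j ∈ ker Hstab`: it kills `rowspace Hstab` and reads off `a_j`). -/
theorem coeffs_eq_zero_of_sum_mem_rowSpace (h : logOK n Hsyn Hstab L Ld = true) {a : Fin L.length → ZMod 2}
    (ha : ∑ i, a i • logVec n L i ∈ rowSpace (rowMatrix n Hstab)) (j : Fin L.length) : a j = 0 := by
  have := dotProduct_eq_zero_of_mem_rowSpace ha (mulVec_dual_eq_zero h j)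
  simp only [dotProduct_sum, dotProduct_smul, smul_eq_mul, dual_dotProduct_logVec h, mul_ite, mul_one, mul_zero,
    Finset.sum_ite_eq', Finset.mem_univ, if_true] at this
  exact this

/-- The logicals are linearly independent. -/
theorem linearIndependent_logVec (h : logOK n Hsyn Hstab L Ld = true) : LinearIndependent (ZMod 2) (logVec n L) := by
  rw [Fintype.linearIndependent_iff]
  intro g hg j
  exact coeffs_eq_zero_of_sum_mem_rowSpace h (by rw [hg]; exact Submodule.zero_mem _) j

/-- The logicals meet the stabilizer row space trivially. -/
theorem rowSpace_inf_span_logVec (h : logOK n Hsyn Hstab L Ld = true) :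
    rowSpace (rowMatrix n Hstab) ⊓ Submodule.span (ZMod 2) (Set.range (logVec n L)) = ⊥ := by
  rw [← disjoint_iff, Submodule.disjoint_def]
  intro x hx hx'
  rw [Submodule.mem_span_range_iff_exists_fun] at hx'
  obtain ⟨a, rfl⟩ := hx'
  have ha : ∀ j, a j = 0 := coeffs_eq_zero_of_sum_mem_rowSpace h hx
  simp [ha]

/-- **Lemma L1**: `ker Hsyn = rowspace Hstab ⊔ span L`, given the two rank certificates, the pairing, and the
dimension identity `n = r_syn + r_stab + k`. -/
theorem ker_eq_rowSpace_sup_span (hcomm : rowMatrix n Hsyn * (rowMatrix n Hstab)ᵀ = 0)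
    (hY : rcY.check n Hsyn = true) (hS : rcS.check n Hstab = true) (hL : logOK n Hsyn Hstab L Ld = true)
    (hdim : n = rcY.r + rcS.r + L.length) :
    pcCode (rowMatrix n Hsyn) =
      rowSpace (rowMatrix n Hstab) ⊔ Submodule.span (ZMod 2) (Set.range (logVec n L)) := by
  symm
  have hle : rowSpace (rowMatrix n Hstab) ⊔ Submodule.span (ZMod 2) (Set.range (logVec n L)) ≤
      pcCode (rowMatrix n Hsyn) := by
    refine sup_le ?_ (Submodule.span_le.2 ?_)
    · exact (CSSCode.ofMatrices (rowMatrix n Hsyn) (rowMatrix n Hstab) hcomm).rowSpZ_le_kerX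
    · rintro _ ⟨i, rfl⟩
      exact mulVec_logVec_eq_zero hL i
  refine Submodule.eq_of_le_of_finrank_eq hle ?_
  have hsup := Submodule.finrank_sup_add_finrank_inf_eq (rowSpace (rowMatrix n Hstab))
    (Submodule.span (ZMod 2) (Set.range (logVec n L)))
  rw [rowSpace_inf_span_logVec hL, finrank_bot, add_zero, finrank_span_eq_card (linearIndependent_logVec hL),
    Fintype.card_fin, finrank_rowSpace_eq_rank, rank_rowMatrix_of_check hS] at hsup
  have hrn := rank_add_finrank_pcCode (rowMatrix n Hsyn)
  rw [rank_rowMatrix_of_check hY, Fintype.card_fin] at hrn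
  omega

/-- **L1, pointwise**: every `z` with `Hsyn z = 0` is a stabilizer-row combination plus a combination of the
logicals: `z − Σ aᵢ Lᵢ ∈ rowspace Hstab` for some coefficient vector `a`. -/
theorem exists_coeffs_of_ker (hcomm : rowMatrix n Hsyn * (rowMatrix n Hstab)ᵀ = 0)
    (hY : rcY.check n Hsyn = true) (hS : rcS.check n Hstab = true) (hL : logOK n Hsyn Hstab L Ld = true)
    (hdim : n = rcY.r + rcS.r + L.length) {z : Fin n → ZMod 2} (hz : rowMatrix n Hsyn *ᵥ z = 0) :
    ∃ a : Fin L.length → ZMod 2, z - ∑ i, a i • logVec n L i ∈ rowSpace (rowMatrix n Hstab) := by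
  have hmem : z ∈ pcCode (rowMatrix n Hsyn) := hz
  rw [ker_eq_rowSpace_sup_span hcomm hY hS hL hdim, Submodule.mem_sup] at hmem
  obtain ⟨s, hs, l, hl, rfl⟩ := hmem
  rw [Submodule.mem_span_range_iff_exists_fun] at hl
  obtain ⟨a, rfl⟩ := hl
  exact ⟨a, by simpa using hs⟩

end L1

/-! ## Control: the `[[4,2,2]]` pairing (CERT-FORMAT §8: `LX = {0,2},{0,1}`, `LZ = {0,1},{0,2}`) -/

/-- The `Z`-side pairing check of the `[[4,2,2]]` example certificate passes (`L = LZ = [3, 5]`, `Ld = LX = [5, 3]`). -/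
theorem logOK_C422 : logOK 4 [15] [15] [3, 5] [5, 3] = true := by decide

/-- L1 instantiated: for `[[4,2,2]]`, `ker H^X = rowspace H^Z ⊔ span {Z₀Z₁, Z₀Z₂}` (kernel-checked hypotheses). -/
theorem ker_C422 : pcCode (rowMatrix 4 [15]) =
    rowSpace (rowMatrix 4 [15]) ⊔ Submodule.span (ZMod 2) (Set.range (logVec 4 [3, 5])) :=
  ker_eq_rowSpace_sup_span (rcY := rankCertC422) (rcS := rankCertC422) (Ld := [5, 3])
    (comm_of_commOK (by decide)) check_rankCertC422 check_rankCertC422 logOK_C422 (by decide)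

end Summit.Ventures.QEC.Census
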